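import Literature.NumberTheory.GelbartRogawski1991.LocalDoubledUnitarySplittingDataCM
import Literature.NumberTheory.GelbartRogawski1991.LocalUnitaryUndoubling
import Literature.NumberTheory.GelbartRogawski1991.FiniteAdelicSplittingAssembly
import Literature.RepresentationTheory.HarrisKudlaSweet1996.GlobalSplittingCharacters
import HarnessLib

-- buildfix G11b-3 recipe (LEDGER B13-1/B13-3), as in the GelbartRogawski1991 siblings: elaborate sequentially so the
-- trailing `attribute [implicit_reducible]` block is in force at `.olean` export (inert for the kernel).
set_option Elab.async false

/-!
# The local splittings of an (undoubled) CM unitary group at every finite place, as `FinLocalSplittings`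

[GelbartRogawski1991, §3.1 Prop. 3.1.1 p. 455 L1–3] ("at each place `v` … a homomorphism `s_v : G_v → Mp(W_v)`"),
by doubling [Kudla1994, Thm. 3.1; HarrisKudlaSweet1996, §1], for a CM field `L`, its maximal real subfield `L⁺`, ANY
symmetric `T₀ ∈ GL_n(L⁺)` (the Gram matrix of a hermitian space `𝕍` over `L` in an orthogonal basis; `J = T₀ ⊗ 1`) and a
Hecke character `χ` of `L` extending `ε_{L/L⁺}` (`IsSplittingChar L 1 χ`; such `χ` exist,
`exists_isUnitary_isSplittingChar_one`):

* §1 at one finite place `v` of `L⁺`, Haar data `μ`: **`localSplittingCMWith … v μ : U(J)(L⁺_v) →* S̃p(𝕎_v)`** — the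
  tree's local splitting of the DOUBLED group `U(T₀ ⊕ −T₀)(L⁺_v)` (`localSplittingDatumCM`, Kudla's splitting on the
  Siegel big cell) restricted to `U(T₀) × 1` and STRIPPED of the second variables (`undoubleLoc`,
  `LocalUnitaryUndoubling`); it lies over `ι_v` (`proj_localSplittingCMWith`), its Weil representation on `𝒮(L⁺_v^n)` is
  SMOOTH (`isSmooth_localSplittingCMWith`), and at a good place `U(J)(𝒪_v)` fixes `1_{𝒪_v^n}`
  (`localSplittingCMWith_unitVec`);
* §2 with the Borel σ-algebra and Mathlib's `addHaar` at every `v`: **`finLocalSplittingsCM L n hT₀ hT₀d hJ χ hχ :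
  FinLocalSplittings L⁺ L c n … T₀ hT₀ hJ`** — the DATA structure of `FiniteAdelicSplittingAssembly` INSTANTIATED
  (local splittings over `ι_v`, smooth, unramified almost everywhere by `eventually_isGoodPlace_localComponent_inv`),
  and `nonempty_finLocalSplittingsCM` (no `χ` in the statement).

This is the `𝓢` consumed as displayed DATA by `GelbartRogawski1991/UnitaryDualPairLocalReferenceSection`,
`FiniteAdelicWeilCentralCoinvariantsIrreducible` and `Liu2021/Def411WeilCarriers…` (local Weil representations
`𝓢.omegaLoc v`, `Ω = ⊗'_v ω_v`), now a TREE TERM for every `T₀`.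

Topic `NumberTheory/GelbartRogawski1991`; namespace `Literature.NumberTheory.GelbartRogawski1991.UnitaryDualPair.LocalSplitting`.
KERNEL MATHEMATICS ONLY: definitions with bodies + theorems; no named fact, no `sorry`.

## References
* [GelbartRogawski1991] S. Gelbart, J. Rogawski, Invent. Math. 105 (1991), §3.1 Prop. 3.1.1 p. 455, (3.1.3) p. 456.
* [Kudla1994] S. Kudla, Israel J. Math. 87 (1994), Thm. 3.1.
* [HarrisKudlaSweet1996] M. Harris, S. Kudla, W. Sweet, J. AMS 9 (1996), §1.
* [MoeglinVignerasWaldspurger1987] LNM 1291 (1987), Chap. 2 II.1 Rem. (6), II.8.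

## Provenance

LEAN-IN-TREE rule, pub-hodgecm stage-1 cell, seat GR-1 ≡ own-real34 (gen 15): the `FinLocalSplittings` of an
undoubled unitary group, asked for as displayed DATA `𝓢` by the item-(vi) lineage (pub-hodgecm2 item6-p3).
-/

set_option autoImplicit false

noncomputable section

open NumberField IsDedekindDomain Matrix MeasureTheory
open Literature.RepresentationTheory.HeisenbergGroup
open Literature.NumberTheory.Automorphic Literature.NumberTheory.Weil1964
open Literature.NumberTheory.GaloisRepresentations
open Literature.RepresentationTheory.HarrisKudlaSweet1996

namespace Literature.NumberTheory.GelbartRogawski1991.UnitaryDualPair.LocalSplitting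

variable (L : Type) [Field L] [NumberField L] [IsCMField L] (n : ℕ) {T₀ : Matrix (Fin n) (Fin n) (maximalRealSubfield L)}
  (hT₀ : T₀.IsSymm) (hT₀d : IsUnit T₀.det) {J : Matrix (Fin n) (Fin n) L}
  (hJ : J = T₀.map (algebraMap (maximalRealSubfield L) L)) (χ : HeckeCharacter L) (hχ : IsSplittingChar L 1 χ)

local notation "L⁺" => maximalRealSubfield L
local notation "cL" => IsCMField.complexConj L

/-! ## §1 The undoubled local splitting at one place -/

section OnePlace

variable (v : HeightOneSpectrum (𝓞 (maximalRealSubfield L))) [MeasurableSpace (v.adicCompletion (maximalRealSubfield L))]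
  [BorelSpace (v.adicCompletion (maximalRealSubfield L))] (μ : Measure (v.adicCompletion (maximalRealSubfield L)))
  [μ.IsAddHaarMeasure]

/-- **the local splitting of `U(J)(L⁺_v)` into `S̃p(𝕎_v)` at the CM data** (Haar data `μ`): the tree's splitting of the
doubled group `localSplittingDatumCM … v μ` restricted to `U(T₀) × 1` and stripped (`undoubleLoc`).
[cite: GelbartRogawski1991, §3.1 Prop. 3.1.1 p. 455 L1–3] -/
def localSplittingCMWith : UnitaryGroup.localPi L cL n J v →* LocalMp L⁺ n T₀ v :=
  undoubleLoc L⁺ L cL v n hJ rfl (complexConj_imagUnit L) (imagUnit_ne_zero L) (imagUnit_mul_self L)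
    hT₀ hT₀d (localSplittingDatumCM L v μ n hT₀ hT₀d rfl χ hχ).localSplitting
    fun g => (localSplittingDatumCM L v μ n hT₀ hT₀d rfl χ hχ).proj_localSplitting g

/-- `π ∘ s_v = ι_v`. [cite: GelbartRogawski1991, §3.1 Prop. 3.1.1 p. 455 L1–3] -/
theorem proj_localSplittingCMWith (g : UnitaryGroup.localPi L cL n J v) :
    MpPsi.proj _ (localSplittingCMWith L n hT₀ hT₀d hJ χ hχ v μ g) =
      iota L⁺ L cL n (complexConj_imagUnit L) (imagUnit_ne_zero L) (imagUnit_mul_self L) T₀ hT₀ hJ v g :=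
  proj_undoubleLoc L⁺ L cL v n hJ rfl (complexConj_imagUnit L) (imagUnit_ne_zero L) (imagUnit_mul_self L) hT₀ hT₀d _ _ g

/-- **the local Weil representation along `s_v` is smooth**: every `Φ ∈ 𝒮(L⁺_v^n)` has an open stabiliser (the
preimage under `g ↦ g ⊕ 1` of the open stabiliser of `Φ ⊠ 1_{𝒪^n}` under the doubled datum, `⊠`-cancellation).
[cite: MoeglinVignerasWaldspurger1987, Chap. 2 II.8] -/
theorem isSmooth_localSplittingCMWith :
    Representation.IsSmooth ((MpPsi.toRep (localSchrodinger L⁺ n T₀ v)).comp (localSplittingCMWith L n hT₀ hT₀d hJ χ hχ v μ)) := by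
  intro Φ
  have hne : unitVec L⁺ (Fin n) v ≠ 0 := fun h0 => by
    have h1 : ((unitVec L⁺ (Fin n) v : SchwartzBruhat (Fin n → v.adicCompletion L⁺)) : (Fin n → v.adicCompletion L⁺) → ℂ) 0 = 1 :=
      unitVec_apply_of_mem fun i _ => (v.adicCompletionIntegers L⁺).zero_mem
    rw [h0, ZeroMemClass.coe_zero, Pi.zero_apply] at h1
    exact zero_ne_one h1
  obtain ⟨U, hU, hfix⟩ := exists_open_forall_toRep_undoubleLoc_eq L⁺ L cL v n hJ rfl (complexConj_imagUnit L)
    (imagUnit_ne_zero L) (imagUnit_mul_self L) hT₀ hT₀d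
    (localSplittingDatumCM L v μ n hT₀ hT₀d rfl χ hχ).localSplitting
    (fun g => (localSplittingDatumCM L v μ n hT₀ hT₀d rfl χ hχ).proj_localSplitting g) Φ hne
    ((localSplittingDatumCM L v μ n hT₀ hT₀d rfl χ hχ).smooth
      (boxSB (v.adicCompletion L⁺) (e₂ n) Φ (unitVec L⁺ (Fin n) v)))
  exact Representation.isSmoothVector_of_le _ hU fun k hk => (Representation.mem_stabilizerSubgroup _ _ _).2 (hfix k hk)

/-- **at a good place `U(J)(𝒪_v)` fixes `1_{𝒪_v^n}`** (from the doubled datum's unramified clause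
`localSplittingDatumCM_unramified` and `1_{𝒪^{n+n}} = 1_{𝒪^n} ⊠ 1_{𝒪^n}`). [cite: GelbartRogawski1991, §3.1 (3.1.3) p. 456] -/
theorem localSplittingCMWith_unitVec
    (hgood : IsGoodPlace L⁺ L (imagUnit L) v n T₀ (fun w' : UnitaryGroup.PlacesOver L v => (χ.localComponent w'.1)⁻¹))
    (k : UnitaryGroup.localPi L cL n J v) (hk : k ∈ UnitaryGroup.localInt L cL n J v) :
    MpPsi.toRep (localSchrodinger L⁺ n T₀ v) (localSplittingCMWith L n hT₀ hT₀d hJ χ hχ v μ k) (unitVec L⁺ (Fin n) v) =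
      unitVec L⁺ (Fin n) v :=
  toRep_undoubleLoc_unitVec L⁺ L cL v n hJ rfl (complexConj_imagUnit L) (imagUnit_ne_zero L) (imagUnit_mul_self L) hT₀ hT₀d
    _ _ (localSplittingDatumCM_unramified L v μ n hT₀ hT₀d rfl χ hχ hgood) k hk

end OnePlace

/-! ## §2 The family over all finite places: `FinLocalSplittings` -/

/-- **the local splitting at `v`** with the Borel σ-algebra and Mathlib's additive Haar measure on `L⁺_v` as Haar data.
[cite: GelbartRogawski1991, §3.1 Prop. 3.1.1 p. 455 L1–3] -/
def localSplittingCM (v : HeightOneSpectrum (𝓞 (maximalRealSubfield L))) :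
    UnitaryGroup.localPi L cL n J v →* LocalMp L⁺ n T₀ v := by
  letI : MeasurableSpace (v.adicCompletion L⁺) := borel _
  haveI : BorelSpace (v.adicCompletion L⁺) := ⟨rfl⟩
  exact localSplittingCMWith L n hT₀ hT₀d hJ χ hχ v Measure.addHaar

/-- **`𝓢` — THE FAMILY OF LOCAL SPLITTINGS OF `U(J)`, `J = T₀ ⊗ 1`, AT ALL FINITE PLACES OF `L⁺`** as the tree's
DATA record `FinLocalSplittings` (`FiniteAdelicSplittingAssembly`): over `ι_v`, smooth, unramified almost everywhere
(the good places of `LocalDoubledUnitaryGoodPlace` are cofinite, `eventually_isGoodPlace_localComponent_inv`).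
[cite: GelbartRogawski1991, §3.1 Prop. 3.1.1 p. 455 L1–3] -/
def finLocalSplittingsCM :
    FinLocalSplittings L⁺ L cL n (complexConj_imagUnit L) (imagUnit_ne_zero L) (imagUnit_mul_self L) T₀ hT₀ hJ where
  s := localSplittingCM L n hT₀ hT₀d hJ χ hχ
  proj_s v g := by
    letI : MeasurableSpace (v.adicCompletion L⁺) := borel _
    haveI : BorelSpace (v.adicCompletion L⁺) := ⟨rfl⟩
    exact proj_localSplittingCMWith L n hT₀ hT₀d hJ χ hχ v Measure.addHaar g
  smooth v := by
    letI : MeasurableSpace (v.adicCompletion L⁺) := borel _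
    haveI : BorelSpace (v.adicCompletion L⁺) := ⟨rfl⟩
    exact isSmooth_localSplittingCMWith L n hT₀ hT₀d hJ χ hχ v Measure.addHaar
  unramified :=
    (eventually_isGoodPlace_localComponent_inv L n hT₀d χ).mono fun v hgood => by
      letI : MeasurableSpace (v.adicCompletion L⁺) := borel _
      haveI : BorelSpace (v.adicCompletion L⁺) := ⟨rfl⟩
      exact localSplittingCMWith_unitVec L n hT₀ hT₀d hJ χ hχ v Measure.addHaar hgood

/-- the local splitting of the family at `v` is `localSplittingCM … v`. [cite: GelbartRogawski1991, §3.1 Prop. 3.1.1 p. 455 L1–3] -/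
@[simp] theorem finLocalSplittingsCM_s (v : HeightOneSpectrum (𝓞 (maximalRealSubfield L))) :
    (finLocalSplittingsCM L n hT₀ hT₀d hJ χ hχ).s v = localSplittingCM L n hT₀ hT₀d hJ χ hχ v := rfl

include hT₀d in
/-- **local splittings exist for every CM unitary group** `U(T₀ ⊗ 1)`, `T₀ ∈ GL_n(L⁺)` symmetric, at all finite places, in
the shape `FinLocalSplittings` — unconditionally (a splitting character `χ` exists, [HarrisKudlaSweet1996, §1]).
[cite: GelbartRogawski1991, §3.1 Prop. 3.1.1 p. 455 L1–3] -/
theorem nonempty_finLocalSplittingsCM :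
    Nonempty (FinLocalSplittings L⁺ L cL n (complexConj_imagUnit L) (imagUnit_ne_zero L) (imagUnit_mul_self L) T₀ hT₀ hJ) := by
  obtain ⟨χ', -, hχ'⟩ := exists_isUnitary_isSplittingChar_one (L := L)
  exact ⟨finLocalSplittingsCM L n hT₀ hT₀d hJ χ' hχ'⟩

/-! ### Build-lane note (ops-buildfix G11b-3 recipe, as in the sibling GelbartRogawski1991 files): the public theorems are tagged
`[implicit_reducible]` purely to keep their large binder telescopes out of Lean's library-suggestion index at `lean -o`;
inert for the kernel, no statement or proof is changed. -/
set_option allowUnsafeReducibility true in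
attribute [implicit_reducible]
  proj_localSplittingCMWith
  isSmooth_localSplittingCMWith
  localSplittingCMWith_unitVec
  finLocalSplittingsCM_s
  nonempty_finLocalSplittingsCM

end Literature.NumberTheory.GelbartRogawski1991.UnitaryDualPair.LocalSplitting

end
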